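import Mathlib
import HarnessLib
import Summits.Ventures.LatticeQCDFlow.Exactness.IMHSignObservableSandwich
import Summits.Ventures.LatticeQCDFlow.Exactness.LatticeBlockSecondMomentTensorization

/-!
# The integrated autocorrelation time of an EVENT along an independence sampler on a lattice of compact sites: for every event `A` of target probability `p ∈ (0,1)`, `(p∧(1−p))/(p∨(1−p))·∫e^{−2F}dπ/(∫e^{−F}dπ)² − ½ ≤ τ_int(1_A) ≤ ½ + 12·(p∨(1−p))/(p∧(1−p))·∫e^{−2F}dπ/(∫e^{−F}dπ)²`, and the block tensorization of the floor — the generic (compact-site) form of `SphereIndependenceSamplerEventTauInt`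

HONEST FRAMING: exact (Metropolis-corrected) sampling algorithms for lattice gauge theory;
figures of merit are autocorrelation/cost numbers at stated couplings and volumes; no
continuum-physics claim.

Venture `LatticeQCDFlow` (cell pub-lqcd), topic `Exactness`; FANOUT row 7 (`s0-cpn-null`).  NEW WORK
of the cell over row 2's `Exactness/IMHSignObservableSandwich.lean` / `IMHTauIntLeInvESS.lean`
(`imhOp_tauInt_ge_weightMean`, `imhOp_tauInt_le_invESS`: the `g²`-weighted second-moment floor and the
inverse-ESS ceiling of `τ_int` for bounded centred observables of the exact flow sampler on a general
state space) and this lineage's `Exactness/LatticeBlockSecondMomentTensorization.lean` (the non-product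
tensorization of the second moment of the weights on a finite product of compact probability spaces,
`Exactness/LatticeCoordAvg.lean` for `A_C`); nothing is cited as a fact.  Printed counterparts, NAMED
ONLY: Albergo–Kanwar–Shanahan 2019 §II; Madras–Sokal 1988 / Wolff 2004 (`τ_int`); Abbott et al.,
Phys. Rev. D 106 (2022) 074506, §V; the venture's barrier B1 `Scaling/Barriers.VolumeScalingOfTraining`
(theory-2: finite state spaces, product prior, FORWARD relative entropy, block defect a hypothesis).
THE GENERIC FORM, FOR EVERY COMPACT-SITE LATTICE MODEL (spins `S(E)`, gauge links in a compact group,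
…).  Sites `ι` (finite), a compact metric site space `X` with a Borel probability measure `μ`,
`π = ⊗_ι μ`; a continuous log-weight `F` on `Ω = X^ι` (target `π.tilted(−F)`, e.g. the effective
action of ANY exact flow sampler in flowed coordinates); the independence Metropolis sampler proposing
from `π` is row 2's `imhOp π e^{−F} 1`.  For EVERY measurable event `A ⊆ Ω` with target probability
`p ∈ (0,1)` (a topological sector, the sign of a charge, …), the centred indicator `1_A − p` obeys
`(p∧(1−p))/(p∨(1−p))·W₂/Z² − ½ ≤ τ_int(1_A) ≤ ½ + 12·(p∨(1−p))/(p∧(1−p))·W₂/Z²`,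
`W₂/Z² = ∫e^{−2F}dπ/(∫e^{−F}dπ)²`; and if `F` is within `δ` of a sum of block-local terms `h_j`
(pairwise disjoint dependence sets `D_j ⊇ B_j`, oscillation `≤ M_j`) plus a corridor term off `⋃_j B_j`,
then with `C = ι ∖ ⋃_j B_j`:
`τ_int(1_A) ≥ (p∧(1−p))/(p∨(1−p))·e^{−4δ}·exp(Σ_j e^{−4M_j}·Var_π(A_C h_j)/(1 + M_j²)) − ½` — a sampler
whose log-weight is local up to `δ` over `#T` congruent non-degenerate blocks has `τ_int` of every
sector indicator at least `exp(#T·θ − 4δ)` up to the factor `(p∧(1−p))/(p∨(1−p))` and `−½`: THE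
VOLUME BARRIER FOR FIXED-RECEPTIVE-FIELD EXACT SAMPLERS ON CONTINUOUS COMPACT CONFIGURATION SPACES, with
the block defect an explicit conditional variance.  (The lattice-of-spheres instance is
`SphereIndependenceSamplerEventTauInt`; the closed form for the exact leading-order flow of the
CP(N−1)/O(N) model of record is `TorusLinkSignObservableTauInt`.)

## Content (`F` continuous; `A` measurable with `0 < ∫_A e^{−F}dπ < ∫e^{−F}dπ`; `p = ∫_A e^{−F}dπ/∫e^{−F}dπ`;
## `τ_int(1_A) = Scoring.tauInt` of the autocorrelation sequence of `1_A − p` along `imhOp π e^{−F} 1`)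

* **`latticeIndep_event_tauInt_sandwich`** — the displayed two-sided bound.
* **`latticeIndep_event_tauInt_ge_exp_blockSum`** — the tensorized floor.

NOT CLAIMED: non-compact sites (row 2's `ℝ^Λ` φ⁴ files have their own weight-moment hypotheses);
general real observables; anything model-specific; numbers.
-/

noncomputable section

namespace Summit.Ventures.LatticeQCDFlow.Exactness

open Function Set Metric MeasureTheory NormedSpace InnerProductSpace
open Summit.Ventures.LatticeQCDFlow.Scoring
open scoped RealInnerProductSpace Topology

/-! ## §1 The event sandwich on a lattice of compact sites -/

section Event

variable {ι : Type*} [Fintype ι] [DecidableEq ι]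
variable {X : Type*} [MeasurableSpace X] [MetricSpace X] [CompactSpace X] [BorelSpace X]
  (μ : Measure X) [IsProbabilityMeasure μ]

omit [DecidableEq ι] in
/-- **THE EVENT SANDWICH (compact sites).**  `π = ⊗_ι μ` on `X^ι`, `X` compact metric, `μ` a Borel
probability measure; `F` continuous; `A` measurable with `0 < ∫_A e^{−F}dπ < ∫e^{−F}dπ` (target
probability `p ∈ (0,1)`):
`(p∧(1−p))/(p∨(1−p))·∫e^{−2F}/(∫e^{−F})² − ½ ≤ τ_int(1_A) ≤ ½ + 12·(p∨(1−p))/(p∧(1−p))·∫e^{−2F}/(∫e^{−F})²`,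
`τ_int(1_A)` the integrated autocorrelation time of `1_A − p` along the stationary exact chain
`imhOp π e^{−F} 1`. -/
theorem latticeIndep_event_tauInt_sandwich {F : (ι → X) → ℝ} (hF : Continuous F)
    {A : Set (ι → X)} (hA : MeasurableSet A)
    (hA0 : 0 < ∫ ω in A, Real.exp (-F ω) ∂Measure.pi (fun _ : ι => μ))
    (hA1 : ∫ ω in A, Real.exp (-F ω) ∂Measure.pi (fun _ : ι => μ) <
      ∫ ω, Real.exp (-F ω) ∂Measure.pi (fun _ : ι => μ)) :
    min ((∫ ω in A, Real.exp (-F ω) ∂Measure.pi (fun _ : ι => μ)) / (∫ ω, Real.exp (-F ω) ∂Measure.pi (fun _ : ι => μ))) (1 - ((∫ ω in A, Real.exp (-F ω) ∂Measure.pi (fun _ : ι => μ)) / (∫ ω, Real.exp (-F ω) ∂Measure.pi (fun _ : ι => μ)))) /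
          max ((∫ ω in A, Real.exp (-F ω) ∂Measure.pi (fun _ : ι => μ)) / (∫ ω, Real.exp (-F ω) ∂Measure.pi (fun _ : ι => μ))) (1 - ((∫ ω in A, Real.exp (-F ω) ∂Measure.pi (fun _ : ι => μ)) / (∫ ω, Real.exp (-F ω) ∂Measure.pi (fun _ : ι => μ)))) *
          ((∫ ω, Real.exp (-2 * F ω) ∂Measure.pi (fun _ : ι => μ)) /
          (∫ ω, Real.exp (-F ω) ∂Measure.pi (fun _ : ι => μ)) ^ 2) - 1 / 2 ≤
      tauInt (fun k => (∫ ω, (A.indicator (fun _ => (1 : ℝ)) ω - ((∫ ω in A, Real.exp (-F ω) ∂Measure.pi (fun _ : ι => μ)) / (∫ ω, Real.exp (-F ω) ∂Measure.pi (fun _ : ι => μ)))) *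
          ((imhOp (Measure.pi (fun _ : ι => μ)) (fun η => Real.exp (-F η)) (fun _ => (1 : ℝ)))^[k]
            (fun ω => A.indicator (fun _ => (1 : ℝ)) ω -
            ((∫ ω in A, Real.exp (-F ω) ∂Measure.pi (fun _ : ι => μ)) / (∫ ω, Real.exp (-F ω) ∂Measure.pi (fun _ : ι => μ))))) ω * Real.exp (-F ω) ∂Measure.pi (fun _ : ι => μ)) /
          ∫ ω, (A.indicator (fun _ => (1 : ℝ)) ω - ((∫ ω in A, Real.exp (-F ω) ∂Measure.pi (fun _ : ι => μ)) / (∫ ω, Real.exp (-F ω) ∂Measure.pi (fun _ : ι => μ)))) ^ 2 * Real.exp (-F ω) ∂Measure.pi (fun _ : ι => μ)) ∧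
    tauInt (fun k => (∫ ω, (A.indicator (fun _ => (1 : ℝ)) ω - ((∫ ω in A, Real.exp (-F ω) ∂Measure.pi (fun _ : ι => μ)) / (∫ ω, Real.exp (-F ω) ∂Measure.pi (fun _ : ι => μ)))) *
          ((imhOp (Measure.pi (fun _ : ι => μ)) (fun η => Real.exp (-F η)) (fun _ => (1 : ℝ)))^[k]
            (fun ω => A.indicator (fun _ => (1 : ℝ)) ω -
            ((∫ ω in A, Real.exp (-F ω) ∂Measure.pi (fun _ : ι => μ)) / (∫ ω, Real.exp (-F ω) ∂Measure.pi (fun _ : ι => μ))))) ω * Real.exp (-F ω) ∂Measure.pi (fun _ : ι => μ)) /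
          ∫ ω, (A.indicator (fun _ => (1 : ℝ)) ω - ((∫ ω in A, Real.exp (-F ω) ∂Measure.pi (fun _ : ι => μ)) / (∫ ω, Real.exp (-F ω) ∂Measure.pi (fun _ : ι => μ)))) ^ 2 * Real.exp (-F ω) ∂Measure.pi (fun _ : ι => μ)) ≤
      1 / 2 + 12 * (max ((∫ ω in A, Real.exp (-F ω) ∂Measure.pi (fun _ : ι => μ)) / (∫ ω, Real.exp (-F ω) ∂Measure.pi (fun _ : ι => μ))) (1 - ((∫ ω in A, Real.exp (-F ω) ∂Measure.pi (fun _ : ι => μ)) / (∫ ω, Real.exp (-F ω) ∂Measure.pi (fun _ : ι => μ)))) /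
          min ((∫ ω in A, Real.exp (-F ω) ∂Measure.pi (fun _ : ι => μ)) / (∫ ω, Real.exp (-F ω) ∂Measure.pi (fun _ : ι => μ))) (1 - ((∫ ω in A, Real.exp (-F ω) ∂Measure.pi (fun _ : ι => μ)) / (∫ ω, Real.exp (-F ω) ∂Measure.pi (fun _ : ι => μ))))) *
          ((∫ ω, Real.exp (-2 * F ω) ∂Measure.pi (fun _ : ι => μ)) /
          (∫ ω, Real.exp (-F ω) ∂Measure.pi (fun _ : ι => μ)) ^ 2) := by
  set π : Measure (ι → X) := Measure.pi (fun _ : ι => μ) with hπ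
  set Z : ℝ := ∫ ω, Real.exp (-F ω) ∂π with hZdef
  set ZA : ℝ := ∫ ω in A, Real.exp (-F ω) ∂π with hZAdef
  set p : ℝ := ZA / Z with hpdef
  have hwc : Continuous fun η : ι → X => Real.exp (-F η) := hF.neg.rexp
  have hw0 : ∀ η : ι → X, 0 < Real.exp (-F η) := fun η => Real.exp_pos _
  have hwm : Measurable fun η : ι → X => Real.exp (-F η) := hwc.measurable
  have hwi : Integrable (fun η : ι → X => Real.exp (-F η)) π :=
    integrable_pi_of_continuous _ hwc
  have hq0 : ∀ _η : ι → X, (0 : ℝ) < 1 := fun _ => one_pos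
  have hqm : Measurable fun _ : ι → X => (1 : ℝ) := measurable_const
  have hqi : Integrable (fun _ : ι → X => (1 : ℝ)) π := integrable_const _
  have hq1 : ∫ _ : ι → X, (1 : ℝ) ∂π = 1 := by
    rw [integral_const, smul_eq_mul, mul_one, probReal_univ]
  have hw2c : Continuous fun η : ι → X => Real.exp (-F η) / 1 * Real.exp (-F η) :=
    (hwc.div_const 1).mul hwc
  have hW₂ : Integrable (fun η : ι → X => Real.exp (-F η) / 1 * Real.exp (-F η)) π :=
    integrable_pi_of_continuous _ hw2c
  have hZpos : 0 < Z := integral_exp_pos (integrable_pi_of_continuous _ (Real.continuous_exp.comp hF.neg))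
  have hp0 : 0 < p := div_pos hA0 hZpos
  have hp1 : p < 1 := (div_lt_one hZpos).2 hA1
  have hq : 0 < 1 - p := by linarith
  have hmin : 0 < min p (1 - p) := lt_min hp0 hq
  have hmax : 0 < max p (1 - p) := lt_max_of_lt_left hp0
  -- `(p∧(1−p))²/(p(1−p)) = (p∧(1−p))/(p∨(1−p))` and dually
  have hmin_eq : min p (1 - p) ^ 2 / (p * (1 - p)) = min p (1 - p) / max p (1 - p) := by
    rcases le_total p (1 - p) with h | h
    · rw [min_eq_left h, max_eq_right h, sq, mul_div_mul_left _ _ hp0.ne']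
    · rw [min_eq_right h, max_eq_left h, sq, mul_comm p (1 - p), mul_div_mul_left _ _ hq.ne']
  have hmax_eq : max p (1 - p) ^ 2 / (p * (1 - p)) = max p (1 - p) / min p (1 - p) := by
    rcases le_total p (1 - p) with h | h
    · rw [min_eq_left h, max_eq_right h, sq, mul_comm p (1 - p), mul_div_mul_left _ _ hq.ne']
    · rw [min_eq_right h, max_eq_left h, sq, mul_div_mul_left _ _ hp0.ne']
  -- the centred indicator
  have hgm : Measurable fun ω : ι → X => A.indicator (fun _ => (1 : ℝ)) ω - p :=
    (measurable_const.indicator hA).sub measurable_const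
  have hgb : ∀ ω : ι → X, |A.indicator (fun _ => (1 : ℝ)) ω - p| ≤ max p (1 - p) := by
    intro ω
    by_cases hω : ω ∈ A
    · rw [Set.indicator_of_mem hω, abs_of_pos (by linarith)]
      exact le_max_right _ _
    · rw [Set.indicator_of_notMem hω, zero_sub, abs_neg, abs_of_pos hp0]
      exact le_max_left _ _
  have hZA' : ∫ ω, A.indicator (fun η => Real.exp (-F η)) ω ∂π = ZA := integral_indicator hA
  have hind : ∀ ω : ι → X, A.indicator (fun _ => (1 : ℝ)) ω * Real.exp (-F ω) =
      A.indicator (fun η => Real.exp (-F η)) ω := by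
    intro ω
    by_cases hω : ω ∈ A
    · rw [Set.indicator_of_mem hω, Set.indicator_of_mem hω, one_mul]
    · rw [Set.indicator_of_notMem hω, Set.indicator_of_notMem hω, zero_mul]
  have hg0 : ∫ ω, (A.indicator (fun _ => (1 : ℝ)) ω - p) * Real.exp (-F ω) ∂π = 0 := by
    have e : ∀ ω : ι → X, (A.indicator (fun _ => (1 : ℝ)) ω - p) * Real.exp (-F ω) =
        A.indicator (fun η => Real.exp (-F η)) ω - p * Real.exp (-F ω) := by
      intro ω; rw [sub_mul, hind ω]
    simp_rw [e]
    rw [integral_sub (hwi.indicator hA) (hwi.const_mul p), hZA', integral_const_mul]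
    rw [hpdef, div_mul_cancel₀ _ hZpos.ne', sub_self]
  have hgsq : ∫ ω, (A.indicator (fun _ => (1 : ℝ)) ω - p) ^ 2 * Real.exp (-F ω) ∂π = p * (1 - p) * Z := by
    have e : ∀ ω : ι → X, (A.indicator (fun _ => (1 : ℝ)) ω - p) ^ 2 * Real.exp (-F ω) =
        (1 - 2 * p) * A.indicator (fun η => Real.exp (-F η)) ω + p ^ 2 * Real.exp (-F ω) := by
      intro ω
      by_cases hω : ω ∈ A
      · rw [Set.indicator_of_mem hω, Set.indicator_of_mem hω]; ring
      · rw [Set.indicator_of_notMem hω, Set.indicator_of_notMem hω]; ring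
    simp_rw [e]
    rw [integral_add ((hwi.indicator hA).const_mul _) (hwi.const_mul _), integral_const_mul,
      integral_const_mul, hZA']
    have hZA2 : ZA = p * Z := by rw [hpdef, div_mul_cancel₀ _ hZpos.ne']
    rw [hZA2]
    ring
  have hD : 0 < p * (1 - p) * Z := by positivity
  -- the numerator of row 2's floor: `∫ g²·(w/1·w) ≥ (p∧(1−p))²·∫e^{−2F}`
  have hw2 : ∀ ω : ι → X, Real.exp (-F ω) / 1 * Real.exp (-F ω) = Real.exp (-2 * F ω) := by
    intro ω; rw [div_one, ← Real.exp_add]; congr 1; ring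
  have hnum : min p (1 - p) ^ 2 * ∫ ω, Real.exp (-2 * F ω) ∂π ≤
      ∫ ω, (A.indicator (fun _ => (1 : ℝ)) ω - p) ^ 2 * (Real.exp (-F ω) / 1 * Real.exp (-F ω)) ∂π := by
    rw [← integral_const_mul]
    refine integral_mono ((integrable_pi_of_continuous _ (continuous_const.mul hF).rexp).const_mul _)
      ?_ fun ω => ?_
    · refine hW₂.bdd_mul (c := max p (1 - p) ^ 2) (hgm.pow_const 2).aestronglyMeasurable
        (ae_of_all _ fun ω => ?_)
      rw [Real.norm_eq_abs, abs_pow, sq_abs, ← sq_abs]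
      exact pow_le_pow_left₀ (abs_nonneg _) (hgb ω) 2
    · show min p (1 - p) ^ 2 * Real.exp (-2 * F ω) ≤
        (A.indicator (fun _ => (1 : ℝ)) ω - p) ^ 2 * (Real.exp (-F ω) / 1 * Real.exp (-F ω))
      rw [hw2 ω]
      refine mul_le_mul_of_nonneg_right ?_ (Real.exp_pos _).le
      by_cases hω : ω ∈ A
      · rw [Set.indicator_of_mem hω]
        have h1 : min p (1 - p) ≤ 1 - p := min_le_right _ _
        nlinarith [hmin]
      · rw [Set.indicator_of_notMem hω, zero_sub, neg_sq]
        have h1 : min p (1 - p) ≤ p := min_le_left _ _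
        nlinarith [hmin]
  have hW2eq : ∫ ω, Real.exp (-F ω) / 1 * Real.exp (-F ω) ∂π = ∫ ω, Real.exp (-2 * F ω) ∂π :=
    integral_congr_ae (ae_of_all _ fun ω => hw2 ω)
  constructor
  · have hlow := imhOp_tauInt_ge_weightMean hw0 hwm hwi hq0 hqm hqi hq1 hW₂ hgm hgb hg0
    rw [← hZdef] at hlow
    refine le_trans ?_ hlow
    rw [hgsq, ← hmin_eq]
    refine sub_le_sub_right ?_ _
    -- `min²/(p(1−p)) · W₂/Z² ≤ ∫g²w² / (Z·(p(1−p)Z))`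
    rw [div_mul_div_comm, div_le_div_iff₀ (by positivity) (by positivity)]
    calc min p (1 - p) ^ 2 * (∫ ω, Real.exp (-2 * F ω) ∂π) * (Z * (p * (1 - p) * Z))
        = (min p (1 - p) ^ 2 * ∫ ω, Real.exp (-2 * F ω) ∂π) * (p * (1 - p) * Z ^ 2) := by ring
      _ ≤ (∫ ω, (A.indicator (fun _ => (1 : ℝ)) ω - p) ^ 2 * (Real.exp (-F ω) / 1 * Real.exp (-F ω)) ∂π) *
            (p * (1 - p) * Z ^ 2) := mul_le_mul_of_nonneg_right hnum (by positivity)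
  · have hup := imhOp_tauInt_le_invESS hw0 hwm hwi hq0 hqm hqi hq1 hW₂ hgm hgb hg0
    rw [← hZdef] at hup
    refine hup.trans ?_
    rw [hgsq, hW2eq, ← hmax_eq]
    apply le_of_eq
    field_simp

/-- **THE TENSORIZED `τ_int` FLOOR FOR EVENTS (compact sites).**  Blocks `B_j ⊆ D_j`, `D_j` pairwise disjoint
(`j ∈ T`); `h_j` continuous, depending on `D_j`, with oscillation `≤ M_j` (`0 ≤ M_j`); `r`
continuous depending on the complement of `⋃_j B_j`; `C = Λ ∖ ⋃_j B_j`; a continuous log-weight `F`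
with `|F − (Σ_j h_j + r)| ≤ δ`; a measurable event `A` of target probability `p ∈ (0,1)`.  Then
`(p∧(1−p))/(p∨(1−p))·e^{−4δ}·exp(Σ_j e^{−4M_j}·∫(A_C h_j − ∫h_j)²dπ/(1 + M_j²)) − ½ ≤ τ_int(1_A)`. -/
theorem latticeIndep_event_tauInt_ge_exp_blockSum {J : Type*} (T : Finset J) (B D : J → Finset ι)
    (hBD : ∀ j ∈ T, B j ⊆ D j) (hD : ∀ j ∈ T, ∀ j' ∈ T, j ≠ j' → Disjoint (D j) (D j'))
    {h : J → (ι → X) → ℝ} (hc : ∀ j ∈ T, Continuous (h j))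
    (hdep : ∀ j ∈ T, DependsOn (h j) ↑(D j))
    {M : J → ℝ} (hM0 : ∀ j ∈ T, 0 ≤ M j) (hM : ∀ j ∈ T, ∀ ω ω', |h j ω - h j ω'| ≤ M j)
    {r : (ι → X) → ℝ} (hr : Continuous r) (hrdep : DependsOn r (↑(T.biUnion B) : Set ι)ᶜ)
    {F : (ι → X) → ℝ} (hF : Continuous F) {δ : ℝ}
    (hδ : ∀ ω, |F ω - (∑ j ∈ T, h j ω + r ω)| ≤ δ)
    {A : Set (ι → X)} (hA : MeasurableSet A)
    (hA0 : 0 < ∫ ω in A, Real.exp (-F ω) ∂Measure.pi (fun _ : ι => μ))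
    (hA1 : ∫ ω in A, Real.exp (-F ω) ∂Measure.pi (fun _ : ι => μ) <
      ∫ ω, Real.exp (-F ω) ∂Measure.pi (fun _ : ι => μ)) :
    min ((∫ ω in A, Real.exp (-F ω) ∂Measure.pi (fun _ : ι => μ)) / (∫ ω, Real.exp (-F ω) ∂Measure.pi (fun _ : ι => μ))) (1 - ((∫ ω in A, Real.exp (-F ω) ∂Measure.pi (fun _ : ι => μ)) / (∫ ω, Real.exp (-F ω) ∂Measure.pi (fun _ : ι => μ)))) /
          max ((∫ ω in A, Real.exp (-F ω) ∂Measure.pi (fun _ : ι => μ)) / (∫ ω, Real.exp (-F ω) ∂Measure.pi (fun _ : ι => μ))) (1 - ((∫ ω in A, Real.exp (-F ω) ∂Measure.pi (fun _ : ι => μ)) / (∫ ω, Real.exp (-F ω) ∂Measure.pi (fun _ : ι => μ)))) *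
        (Real.exp (-(4 * δ)) * Real.exp (∑ j ∈ T, Real.exp (-4 * M j) *
          (∫ ω, (coordAvg μ (Finset.univ \ T.biUnion B) (h j) ω -
              ∫ ω', h j ω' ∂Measure.pi (fun _ : ι => μ)) ^ 2
            ∂Measure.pi (fun _ : ι => μ)) / (1 + M j ^ 2))) - 1 / 2 ≤
      tauInt (fun k => (∫ ω, (A.indicator (fun _ => (1 : ℝ)) ω - ((∫ ω in A, Real.exp (-F ω) ∂Measure.pi (fun _ : ι => μ)) / (∫ ω, Real.exp (-F ω) ∂Measure.pi (fun _ : ι => μ)))) *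
          ((imhOp (Measure.pi (fun _ : ι => μ)) (fun η => Real.exp (-F η)) (fun _ => (1 : ℝ)))^[k]
            (fun ω => A.indicator (fun _ => (1 : ℝ)) ω -
            ((∫ ω in A, Real.exp (-F ω) ∂Measure.pi (fun _ : ι => μ)) / (∫ ω, Real.exp (-F ω) ∂Measure.pi (fun _ : ι => μ))))) ω * Real.exp (-F ω) ∂Measure.pi (fun _ : ι => μ)) /
          ∫ ω, (A.indicator (fun _ => (1 : ℝ)) ω - ((∫ ω in A, Real.exp (-F ω) ∂Measure.pi (fun _ : ι => μ)) / (∫ ω, Real.exp (-F ω) ∂Measure.pi (fun _ : ι => μ)))) ^ 2 * Real.exp (-F ω) ∂Measure.pi (fun _ : ι => μ)) := by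
  have hsand := (latticeIndep_event_tauInt_sandwich μ hF hA hA0 hA1).1
  refine le_trans ?_ hsand
  have hmain := sq_integral_exp_neg_mul_exp_le_of_abs_sub_le μ T B D
    hBD hD hc hdep hM0 hM hr hrdep hF hδ
  have hZpos : 0 < ∫ ω, Real.exp (-F ω) ∂Measure.pi (fun _ : ι => μ) :=
    integral_exp_pos (integrable_pi_of_continuous _ (Real.continuous_exp.comp hF.neg))
  have hZ2 : 0 < (∫ ω, Real.exp (-F ω) ∂Measure.pi (fun _ : ι => μ)) ^ 2 := pow_pos hZpos 2
  have hp0 : 0 < ((∫ ω in A, Real.exp (-F ω) ∂Measure.pi (fun _ : ι => μ)) / (∫ ω, Real.exp (-F ω) ∂Measure.pi (fun _ : ι => μ))) := div_pos hA0 hZpos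
  have hp1 : ((∫ ω in A, Real.exp (-F ω) ∂Measure.pi (fun _ : ι => μ)) / (∫ ω, Real.exp (-F ω) ∂Measure.pi (fun _ : ι => μ))) < 1 := (div_lt_one hZpos).2 hA1
  have hcoef : 0 ≤ min ((∫ ω in A, Real.exp (-F ω) ∂Measure.pi (fun _ : ι => μ)) / (∫ ω, Real.exp (-F ω) ∂Measure.pi (fun _ : ι => μ))) (1 - ((∫ ω in A, Real.exp (-F ω) ∂Measure.pi (fun _ : ι => μ)) / (∫ ω, Real.exp (-F ω) ∂Measure.pi (fun _ : ι => μ)))) /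
          max ((∫ ω in A, Real.exp (-F ω) ∂Measure.pi (fun _ : ι => μ)) / (∫ ω, Real.exp (-F ω) ∂Measure.pi (fun _ : ι => μ))) (1 - ((∫ ω in A, Real.exp (-F ω) ∂Measure.pi (fun _ : ι => μ)) / (∫ ω, Real.exp (-F ω) ∂Measure.pi (fun _ : ι => μ)))) :=
    div_nonneg (le_min hp0.le (by linarith)) (le_max_of_le_left hp0.le)
  have key : Real.exp (-(4 * δ)) * Real.exp (∑ j ∈ T, Real.exp (-4 * M j) *
        (∫ ω, (coordAvg μ (Finset.univ \ T.biUnion B) (h j) ω -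
            ∫ ω', h j ω' ∂Measure.pi (fun _ : ι => μ)) ^ 2
          ∂Measure.pi (fun _ : ι => μ)) / (1 + M j ^ 2)) ≤
      ((∫ ω, Real.exp (-2 * F ω) ∂Measure.pi (fun _ : ι => μ)) /
          (∫ ω, Real.exp (-F ω) ∂Measure.pi (fun _ : ι => μ)) ^ 2) := by
    rw [le_div_iff₀ hZ2, Real.exp_neg, inv_mul_eq_div, div_mul_eq_mul_div, div_le_iff₀ (Real.exp_pos _)]
    calc Real.exp (∑ j ∈ T, Real.exp (-4 * M j) *
            (∫ ω, (coordAvg μ (Finset.univ \ T.biUnion B) (h j) ω -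
                ∫ ω', h j ω' ∂Measure.pi (fun _ : ι => μ)) ^ 2
              ∂Measure.pi (fun _ : ι => μ)) / (1 + M j ^ 2)) *
          (∫ ω, Real.exp (-F ω) ∂Measure.pi (fun _ : ι => μ)) ^ 2
        = (∫ ω, Real.exp (-F ω) ∂Measure.pi (fun _ : ι => μ)) ^ 2 *
          Real.exp (∑ j ∈ T, Real.exp (-4 * M j) *
            (∫ ω, (coordAvg μ (Finset.univ \ T.biUnion B) (h j) ω -
                ∫ ω', h j ω' ∂Measure.pi (fun _ : ι => μ)) ^ 2
              ∂Measure.pi (fun _ : ι => μ)) / (1 + M j ^ 2)) := mul_comm _ _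
      _ ≤ Real.exp (4 * δ) * (∫ ω, Real.exp (-2 * F ω) ∂Measure.pi (fun _ : ι => μ)) := hmain
      _ = (∫ ω, Real.exp (-2 * F ω) ∂Measure.pi (fun _ : ι => μ)) * Real.exp (4 * δ) := mul_comm _ _
  linarith [mul_le_mul_of_nonneg_left key hcoef]

end Event

end Summit.Ventures.LatticeQCDFlow.Exactness

end
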